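import Summits.HodgeConjecture.HodgeConjecture.Theorems.TwinSimilitudeAlgebraic.Negative.NonCMPeriod
import Summits.HodgeConjecture.HodgeConjecture.Theorems.NikulinTwinTransportTwinSimilitudeAlgebraicLattice
import Summits.HodgeConjecture.HodgeConjecture.Theorems.NikulinTwinTransportTwinSimilitudeAlgebraicMarkings
import Summits.HodgeConjecture.HodgeConjecture.Theorems.NikulinTwinTransportTwinSimilitudeAlgebraic
import Summits.HodgeConjecture.HodgeConjecture.Theorems.NikulinSerreCarrier.Negative.OrientationTwist
import Literature.AlgebraicGeometry.HodgeTheory.SupportedClassesRational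
import Literature.AlgebraicGeometry.HodgeTheory.HardLefschetzThreefold

/-!
# `TwinSimilitudeAlgebraic` (stmt-HodgeConjecture-13674, X = Sim₂(K3)) · Negative · the rationality hypothesis is load-bearing

Negative-side knowledge for the crux `NikulinTwinTransport.TwinSimilitudeAlgebraic` (every rational,
type-preserving `2`-similitude `ψ : H²(S′(ℂ);ℂ) → H²(S(ℂ);ℂ)` between projective K3 surfaces is induced
by an algebraic class), extracted from the standing disprover's work file
`Cruxes/TwinSimilitudeAlgebraic/Disproof.lean` (§3b; refuter-cdisprove-stmt-HodgeConjecture-13674-0,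
2026-08-16). Companion of `Negative/FalseWithoutHtype` (the type hypothesis is load-bearing).

`twinSimilitudeAlgebraic_false_without_hrat`: the crux X with its RATIONALITY hypothesis dropped is
FALSE on the tree's real carriers, granted seven named facts (period surjectivity, Hodge types of
`H²(K3)`, `hodgePQ_independent_of_hodgeModel`, `nonempty_hodgeModel`, de Rham, Grothendieck's
`N²H⁴ ⊆ H^{2,2}`, `span_isRationalClass_eq_top_of_isSmoothProjective`). The point of the file is the
CHOICE OF WITNESS: at CM periods (rank `T = 2`) an irrational type-preserving twist of the twin
similitude is a `ℂ`-combination of rational Hodge similitudes and cannot serve; at the explicit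
quadratic period `x₁ = (e₁+f₁) + i(√2(e₂+f₂) + (e₂−f₂))` (`ρ = 19`, `T ≅ ⟨2⟩ ⊕ U` of ODD rank 3) the
endomorphism field of `T` is `ℚ` by an ELEMENTARY argument (`ratEnd_aV_of_eigen`: an endomorphism of
`Λ_ℚ` with eigenvector `x₁` acts on `e₁+f₁` by a scalar, because `√2 ∉ ℚ`), so every algebraic
action `[γ]_*` (`γ` a complex combination of RATIONAL algebraic classes, each acting rationally along
the rationally normalised orientation family `ratFamily` and preserving the `(2,0)`-line) maps
`φ′⁻¹(N(e₁+f₁))` into `ℂ·φ⁻¹(e₁+f₁)`, whereas the twisted similitude `R ∘ M` (`R = 2` on `ℂx₁`, `½` on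
`ℂx̄₁`, `1` on the orthogonal complement — a non-real isometry, `twistR`) does not: `(R(e₁+f₁))_{e₂} = ¾(√2+1)i`.
Ingredients: the period facts for `x₁`, the isometry `R` (`twistR`) and the key lemma are in
`Negative/NonCMPeriod`; proved here: a variant `isOfHodgeType_markingConj_of_star` of the landed
`isOfHodgeType_markingConj` in which reality of `ρ` is replaced by the two eigen-relations
`ρ x′ = t x`, `ρ x̄′ = t′ x̄`, and the main theorem.

## References

* [Huybrechts2016K3] D. Huybrechts, Lectures on K3 Surfaces (2016), Ch. 3 §3, Ch. 6 Prop. 1.2 and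
  Rem. 3.3, Ch. 7.
* [Zarhin1983] Yu. G. Zarhin, Hodge groups of K3 surfaces, J. reine angew. Math. 341 (1983), Thm. 1.5.1.
* [VoisinHodgeI2002] C. Voisin, Hodge Theory and Complex Algebraic Geometry I (2002), §7.1.1, §7.3.2,
  Prop. 11.20.
* [Buskin2019] N. Buskin, Every rational Hodge isometry between two K3 surfaces is algebraic,
  J. reine angew. Math. 755 (2019), §6.2.
-/

noncomputable section

open CategoryTheory MonoidalCategory
open scoped Manifold Matrix ComplexConjugate
open Literature.AlgebraicGeometry.Motives Literature.AlgebraicGeometry.HodgeTheory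
open Literature.AlgebraicGeometry.Surfaces Literature.Geometry.Kaehler
open Literature.AlgebraicTopology.SingularHomology
open Literature.LinearAlgebra.QuadraticForm
open Literature.NumberTheory.Transcendental (exists_deRhamIsoFamily)
open Summit.HodgeConjecture.HodgeConjecture.Theses.NikulinTwinTransport
open Summit.HodgeConjecture.HodgeConjecture.Theorems.NikulinTwinTransport
open Summit.HodgeConjecture.HodgeConjecture.Theorems.HodgeSimilitudeAlgebraic.Negative
open Summit.HodgeConjecture.HodgeConjecture.Theorems.NikulinSerreCarrier.Negative.OrientationTwist
  (ratFamily isRationalClass_complexGysin_ratFamily)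

namespace Summit.HodgeConjecture.HodgeConjecture.Theorems.TwinSimilitudeAlgebraic.Negative

/-- `√2` as a complex number. Local notation only. -/
local notation3 (prettyPrint := false) "s2" => ((Real.sqrt 2 : ℝ) : ℂ)

/-- The explicit NON-CM projective period `x₁ = (e₁+f₁) + i(√2(e₂+f₂) + (e₂−f₂))`: `(x₁.x₁) = 0`,
`(x̄₁.x₁) = 4`, `u = e₃+f₃ ⊥ x₁` with `u² = 2`; `T_ℚ = ⟨e₁+f₁⟩ ⊕ U₂` has rank 3 and
`End_Hdg(T) = ℚ` (`ratEnd_aV_of_eigen`). Local notation only. -/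
local notation3 (prettyPrint := false) "x₁P" =>
  (Sum.elim 0 (Sum.elim ![1, 1] (Sum.elim ![(s2 + 1) * Complex.I, (s2 - 1) * Complex.I] 0)) : K3Index → ℂ)

/-- `a = e₁ + f₁`. Local notation only. -/
local notation3 (prettyPrint := false) "aV" =>
  (Sum.elim 0 (Sum.elim ![1, 1] (Sum.elim 0 0)) : K3Index → ℤ)
/-- `b = e₂ + f₂`. Local notation only. -/
local notation3 (prettyPrint := false) "bV" =>
  (Sum.elim 0 (Sum.elim 0 (Sum.elim ![1, 1] 0)) : K3Index → ℤ)
/-- `d = e₂ - f₂`. Local notation only. -/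
local notation3 (prettyPrint := false) "dV" =>
  (Sum.elim 0 (Sum.elim 0 (Sum.elim ![1, -1] 0)) : K3Index → ℤ)
/-- `u = e₃ + f₃`. Local notation only. -/
local notation3 (prettyPrint := false) "uV" =>
  (Sum.elim 0 (Sum.elim 0 (Sum.elim 0 ![1, 1])) : K3Index → ℤ)

/-! ### Hodge types of `η⁻¹ ∘ ρ ∘ η'` without reality of `ρ` -/

/-- **`η⁻¹ ∘ ρ ∘ η'` preserves every Hodge type** — variant of `isOfHodgeType_markingConj` in which
the reality of `ρ` (used there through `ratEnd_star`) is replaced by the two eigen-relations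
`ρ x' = t x`, `ρ x̄' = t' x̄` (`t, t' ≠ 0`): then `H^{2,0} = ℂσ' ↦ ℂσ`, `H^{0,2} = ℂσ̄' ↦ ℂσ̄`, and
`H^{1,1} = ⟨σ', σ̄'⟩^⊥ ↦ ⟨σ, σ̄⟩^⊥` because `ρ` is a similitude (`x = t⁻¹ρx'`, `x̄ = t'⁻¹ρx̄'`).
For `ρ` real, `t' = t̄` and this is the landed lemma. [cite: Huybrechts2016K3, Ch. 6 Prop. 1.2] -/
theorem isOfHodgeType_markingConj_of_star {S S' : SchemeOver ℂ}
    (η : complexBetti S (2 * 1) ≃ₗ[ℂ] (K3Index → ℂ)) (p : complexBetti S (2 * 2)) (x : K3Index → ℂ)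
    (η' : complexBetti S' (2 * 1) ≃ₗ[ℂ] (K3Index → ℂ)) (p' : complexBetti S' (2 * 2))
    (x' : K3Index → ℂ) (ρ : Module.End ℂ (K3Index → ℂ))
    (hHT : Huybrechts_K3_hodgeTypes_H2) (hS : IsK3Surface S) (hS' : IsK3Surface S')
    (hη : ∀ c : complexBetti S (2 * 1), IsIntegralClass c ↔ ∃ v : K3Index → ℤ, η c = fun i => (v i : ℂ))
    (hηcup : ∀ a b : complexBetti S (2 * 1),
      cupProduct (rfl : 2 * 1 + 2 * 1 = 2 * 2) a b = k3Form (η a) (η b) • p)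
    (h20 : IsOfHodgeType 2 S (2 * 1) 2 0 (η.symm x)) (hx : 0 < (k3Form (star x) x).re)
    (hη' : ∀ c : complexBetti S' (2 * 1), IsIntegralClass c ↔ ∃ v : K3Index → ℤ, η' c = fun i => (v i : ℂ))
    (hη'cup : ∀ a b : complexBetti S' (2 * 1),
      cupProduct (rfl : 2 * 1 + 2 * 1 = 2 * 2) a b = k3Form (η' a) (η' b) • p')
    (hp' : p' ≠ 0)
    (h20' : IsOfHodgeType 2 S' (2 * 1) 2 0 (η'.symm x')) (hx' : 0 < (k3Form (star x') x').re)
    {r : ℂ} (hρ : ∀ a b, k3Form (ρ a) (ρ b) = r * k3Form a b)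
    {t t' : ℂ} (ht0 : t ≠ 0) (ht'0 : t' ≠ 0) (hper : ρ x' = t • x)
    (hper' : ρ (star x') = t' • star x) :
    ∀ (i j : ℕ) (y : complexBetti S' (2 * 1)),
      IsOfHodgeType 2 S' (2 * 1) i j y → IsOfHodgeType 2 S (2 * 1) i j (η.symm (ρ (η' y))) := by
  have hσ0 : η.symm x ≠ 0 := fun h0 => ne_zero_of_star_self_re_pos hx (by simpa using congrArg η h0)
  have hσ'0 : η'.symm x' ≠ 0 := fun h0 =>
    ne_zero_of_star_self_re_pos hx' (by simpa using congrArg η' h0)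
  have hxt : x = t⁻¹ • ρ x' := by rw [hper, smul_smul, inv_mul_cancel₀ ht0, one_smul]
  have hxt' : star x = t'⁻¹ • ρ (star x') := by rw [hper', smul_smul, inv_mul_cancel₀ ht'0, one_smul]
  obtain ⟨h1, h2, h3⟩ := hHT S hS (η.symm x) h20 hσ0
  obtain ⟨h1', h2', h3'⟩ := hHT S' hS' (η'.symm x') h20' hσ'0
  intro i j y hy
  by_cases hij : i + j = 2 * 1
  · obtain ⟨rfl, rfl⟩ | ⟨rfl, rfl⟩ | ⟨rfl, rfl⟩ :
        (i = 2 ∧ j = 0) ∨ (i = 0 ∧ j = 2) ∨ (i = 1 ∧ j = 1) := by omega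
    · -- type `(2,0)`
      obtain ⟨t₀, rfl⟩ := (h1' y).1 hy
      refine (h1 _).2 ⟨t₀ * t, ?_⟩
      rw [map_smul, LinearEquiv.apply_symm_apply, map_smul, hper, map_smul, map_smul, smul_smul]
    · -- type `(0,2)`
      obtain ⟨t₀, rfl⟩ := (h2' y).1 hy
      refine (h2 _).2 ⟨t₀ * t', ?_⟩
      rw [map_smul, conjClass_marking_symm η' hη', LinearEquiv.apply_symm_apply, map_smul, hper',
        map_smul, map_smul, ← conjClass_marking_symm η hη, smul_smul]
    · -- type `(1,1)`
      obtain ⟨hc1, hc2⟩ := (h3' y).1 hy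
      have hk1 : k3Form (η' y) x' = 0 := by
        rw [hη'cup, LinearEquiv.apply_symm_apply, smul_eq_zero] at hc1
        exact hc1.resolve_right hp'
      have hk2 : k3Form (η' y) (star x') = 0 := by
        rw [conjClass_marking_symm η' hη', hη'cup, LinearEquiv.apply_symm_apply, smul_eq_zero] at hc2
        exact hc2.resolve_right hp'
      refine (h3 _).2 ⟨?_, ?_⟩
      · rw [hηcup, LinearEquiv.apply_symm_apply, LinearEquiv.apply_symm_apply, hxt,
          k3Form_smul_right, hρ, hk1, mul_zero, mul_zero, zero_smul]
      · rw [conjClass_marking_symm η hη, hηcup, LinearEquiv.apply_symm_apply,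
          LinearEquiv.apply_symm_apply, hxt', k3Form_smul_right, hρ, hk2, mul_zero, mul_zero,
          zero_smul]
  · obtain rfl := isOfHodgeType_eq_zero_of_add_ne hy hij
    rw [map_zero, map_zero, map_zero]
    obtain ⟨A⟩ := hS.nonempty_hodgeModel
    exact IsOfHodgeType.zero A _ _ _

/-! ### Main theorem: `hrat` is load-bearing for X -/

/-- `XWithoutHrat`: the body of the route decl `TwinSimilitudeAlgebraic` with its rationality
hypothesis `hrat` dropped (everything else verbatim). Local notation only. -/
local notation3 (prettyPrint := false) "XWithoutHrat" =>
  ∀ (μ : OrientationFamily), μ.HasPoincareDuality →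
    ∀ (S S' : SchemeOver ℂ)
      (hS : (IsSmoothProjective 2 S ∧ Subsingleton (structureSheafCohomology S.left 1) ∧
        ∃ (A : HodgeModel 2 S) (η : MForm 𝓘(ℝ, A.model) A.carrier ℂ 2),
          IsHolomorphicInCharts η ∧ ∀ x, η x ≠ 0))
      (hS' : (IsSmoothProjective 2 S' ∧ Subsingleton (structureSheafCohomology S'.left 1) ∧
        ∃ (A : HodgeModel 2 S') (η : MForm 𝓘(ℝ, A.model) A.carrier ℂ 2),
          IsHolomorphicInCharts η ∧ ∀ x, η x ≠ 0))
      (p : complexBetti S (2 * 2)) (p' : complexBetti S' (2 * 2)),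
      (IsIntegralClass p ∧ ∀ q : complexBetti S (2 * 2), IsIntegralClass q → ∃ n : ℤ, q = n • p) →
      (IsIntegralClass p' ∧
        ∀ q : complexBetti S' (2 * 2), IsIntegralClass q → ∃ n : ℤ, q = n • p') →
      ∀ (ψ : complexBetti S' (2 * 1) →ₗ[ℂ] complexBetti S (2 * 1)),
        (∀ (i j : ℕ) x, IsOfHodgeType 2 S' (2 * 1) i j x → IsOfHodgeType 2 S (2 * 1) i j (ψ x)) →
        (∀ (x y : complexBetti S' (2 * 1)) (a : ℂ),
          cupProduct (rfl : 2 * 1 + 2 * 1 = 2 * 2) x y = a • p' →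
            cupProduct (rfl : 2 * 1 + 2 * 1 = 2 * 2) (ψ x) (ψ y) = ((2 : ℂ) * a) • p) →
        ∃ γ ∈ algebraicClasses (MonoidalCategoryStruct.tensorObj S S') 2,
          ∀ x : complexBetti S' (2 * 1),
            ψ x = complexGysin μ (IsSmoothProjective.tensor_holds hS.1 hS'.1) hS.1
              (SemiCartesianMonoidalCategory.fst S S')
              (rfl : 2 * 1 + 2 * 2 + 2 * 2 = 2 * 1 + 2 * (2 + 2))
              (cupProduct (rfl : 2 * 1 + 2 * 2 = 2 * 1 + 2 * 2)
                (complexBetti.map (SemiCartesianMonoidalCategory.snd S S') (2 * 1) x) γ)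

/-- **`hrat` is load-bearing for X = `TwinSimilitudeAlgebraic`.** The crux X with its
rationality hypothesis dropped (`XWithoutHrat`: "every type-preserving `ℂ`-linear `2`-similitude
`ψ : H²(S′(ℂ);ℂ) → H²(S(ℂ);ℂ)` between projective K3 surfaces is `[γ]_*` for an algebraic
`γ ∈ N²H⁴(S × S′)`") is FALSE, granted seven named facts of the tree: projective surjectivity of the
period map (`hP`), the Hodge types of `H²(K3)` through the period line (`hHT`), independence of
`H^{p,q}` of the Hodge model (`hI`), existence of Hodge models (`hM`), de Rham's theorem (`hdR`),
Grothendieck's coniveau fact `N²H⁴ ⊆ H^{2,2}` (`hG`) and the universal-coefficient fact that rational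
classes span (`hspan`, giving `N²H⁴ = span_ℂ` of its RATIONAL classes). WITNESS: the marked
projective K3 surface `(S, φ)` with the non-CM period `x₁ = (e₁+f₁) + i(√2(e₂+f₂) + (e₂−f₂))`
(`ρ(S) = 19`, `T ≅ ⟨2⟩ ⊕ U`), its twin `(S′, φ′)` with period `N x₁` (`periodPt_twin`; `M, N` the
rational lattice `2`-similitude of `exists_twoSimilitude_k3Lattice` and its inverse), and
`ψ = φ⁻¹ ∘ R ∘ M ∘ φ′` with `R` the isometry `2` on `ℂx₁`, `½` on `ℂx̄₁`, `1` on `{x₁,x̄₁}^⊥`: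
`ψ` preserves every Hodge type (`isOfHodgeType_markingConj_of_star`) and doubles cup products
(`cupProduct_markingConj`). REFUTATION of algebraicity at the rationally normalised orientation
family `ratFamily` (the mutilated crux quantifies over all families): an algebraic `γ` is
`Σ fᵢ γᵢ` with `γᵢ` RATIONAL algebraic; each action `θᵢ = [γᵢ]_*` preserves rational classes
(`isRationalClass_complexGysin_ratFamily`, `IsRationalClass.map/.cup`) and the type `(2,0)` (Gysin /
cup / pull-back type calculus, `N²H⁴ ⊆ H^{2,2}`), so `σᵢ = φ θᵢ φ′⁻¹` is an endomorphism of `Λ_ℂ`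
defined over `ℚ` with `σᵢ N x₁ ∈ ℂ x₁`; by the KEY LEMMA `ratEnd_aV_of_eigen` (`End_Hdg(T) = ℚ` at
`x₁`, from `√2 ∉ ℚ`), `σᵢ N a ∈ ℂ a` for `a = e₁ + f₁`; summing, `R a = φ ψ φ′⁻¹ (N a) ∈ ℂ a` — but
`(R a)_{e₂} = ¾(√2+1) i ≠ 0 = a_{e₂}`. So any proof of X must use `hrat`. (At CM periods such as
`x₀ = (e₁+f₁)+i(e₂+f₂)` the analogous twist IS a `ℂ`-combination of rational Hodge similitudes;
the witness must avoid CM points, which rank `T = 3` does.)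
[cite: Huybrechts2016K3, Ch. 3 §3 (endomorphism fields of T), Ch. 6 Prop. 1.2, Rem. 3.3]
[cite: VoisinHodgeI2002, §7.1.1, §7.3.2 and Prop. 11.20] [cite: Zarhin1983, Thm. 1.5.1] -/
theorem twinSimilitudeAlgebraic_false_without_hrat
    (hP : Huybrechts_K3_periodSurjective_projective) (hHT : Huybrechts_K3_hodgeTypes_H2)
    (hI : hodgePQ_independent_of_hodgeModel)
    (hM : ∀ (m : ℕ) (Y : SchemeOver ℂ), nonempty_hodgeModel m Y)
    (hdR : ∀ (E : Type) [NormedAddCommGroup E] [NormedSpace ℂ E] [FiniteDimensional ℂ E],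
      exists_deRhamIsoFamily 𝓘(ℝ, E))
    (hG : Grothendieck1969_supportedClasses_le_hodgeConiveau)
    (hspan : span_isRationalClass_eq_top_of_isSmoothProjective) :
    ¬ XWithoutHrat := by
  intro h
  -- the lattice `2`-similitude and the twin periods `x₁`, `N x₁`
  obtain ⟨M, N, hMrat, hNrat, hMN, hNM, hM2⟩ := exists_twoSimilitude_k3Lattice
  have hMN' : ∀ v, M (N v) = v := fun v => by rw [← Module.End.mul_apply, hMN, Module.End.one_apply]
  have hNM' : ∀ v, N (M v) = v := fun v => by rw [← Module.End.mul_apply, hNM, Module.End.one_apply]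
  have hN2 : ∀ a b, k3Form (N a) (N b) = (2 : ℂ)⁻¹ * k3Form a b := by
    intro a b
    have e := hM2 (N a) (N b)
    rw [hMN', hMN'] at e
    rw [e, ← mul_assoc, inv_mul_cancel₀ (two_ne_zero' ℂ), one_mul]
  obtain ⟨hx'1, hx'2, hx'3⟩ :=
    periodPt_twin N hNrat hN2 (x := x₁P) ⟨x₁P_sq, x₁P_pos, uV, uV_x₁P, uV_sq⟩
  obtain ⟨S, hS, φ, p, hpint, hpgen, hφint, hφcup, h20, h20span⟩ :=
    hP x₁P x₁P_sq x₁P_pos ⟨uV, uV_x₁P, uV_sq⟩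
  obtain ⟨S', hS', φ', p', hp'int, hp'gen, hφ'int, hφ'cup, h20', -⟩ := hP (N x₁P) hx'1 hx'2 hx'3
  have hp'0 : p' ≠ 0 := generator_ne_zero hS' hp'gen
  -- `ρ = R ∘ M` and `ψ = φ⁻¹ ∘ ρ ∘ φ'`
  set ρ : Module.End ℂ (K3Index → ℂ) := twistR * M with hρdef
  have hρ2 : ∀ a b, k3Form (ρ a) (ρ b) = 2 * k3Form a b := fun a b => by
    rw [hρdef, Module.End.mul_apply, Module.End.mul_apply, k3Form_twistR, hM2]
  have hper : ρ (N x₁P) = (2 : ℂ) • x₁P := by rw [hρdef, Module.End.mul_apply, hMN', twistR_x₁P]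
  have hper' : ρ (star (N x₁P)) = (2 : ℂ)⁻¹ • star x₁P := by
    rw [hρdef, Module.End.mul_apply, ← ratEnd_star N hNrat, hMN', twistR_star_x₁P]
  set ψ : complexBetti S' (2 * 1) →ₗ[ℂ] complexBetti S (2 * 1) :=
    φ.symm.toLinearMap ∘ₗ ρ ∘ₗ φ'.toLinearMap with hψ
  have hψapply : ∀ y, ψ y = φ.symm (ρ (φ' y)) := fun y => rfl
  have htype : ∀ (i j : ℕ) y, IsOfHodgeType 2 S' (2 * 1) i j y →
      IsOfHodgeType 2 S (2 * 1) i j (ψ y) := by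
    intro i j y hy
    rw [hψapply]
    exact isOfHodgeType_markingConj_of_star φ p x₁P φ' p' (N x₁P) ρ hHT hS hS' hφint hφcup h20
      x₁P_pos hφ'int hφ'cup hp'0 h20' hx'2 hρ2 two_ne_zero (inv_ne_zero two_ne_zero) hper hper'
      i j y hy
  have hsim : ∀ (x y : complexBetti S' (2 * 1)) (a : ℂ),
      cupProduct (rfl : 2 * 1 + 2 * 1 = 2 * 2) x y = a • p' →
        cupProduct (rfl : 2 * 1 + 2 * 1 = 2 * 2) (ψ x) (ψ y) = ((2 : ℂ) * a) • p := by
    intro x y a hxy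
    rw [hψapply, hψapply]
    exact cupProduct_markingConj φ p φ' p' ρ hp'0 hφcup hφ'cup hρ2 x y a hxy
  -- apply the mutilated crux at the rationally normalised orientation family
  obtain ⟨γ, hγ, hψγ⟩ := h ratFamily (OrientationFamily.hasPoincareDuality _) S S' hS hS' p p'
    ⟨hpint, hpgen⟩ ⟨hp'int, hp'gen⟩ ψ htype hsim
  have hSS' : IsSmoothProjective (2 + 2) (S ⊗ S') := IsSmoothProjective.tensor_holds hS.1 hS'.1
  -- `γ` is a complex combination of RATIONAL algebraic classes
  have hγspan : γ ∈ Submodule.span ℂ {c : complexBetti (S ⊗ S') (2 * 2) |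
      IsRationalClass c ∧ c ∈ algebraicClasses (S ⊗ S') 2} :=
    hspan.supportedClasses_le_span hSS' (2 * 2) 2 hγ
  obtain ⟨n, f, g, hsum⟩ := Submodule.mem_span_set'.1 hγspan
  -- the actions of the rational pieces
  let θ : Fin n → (complexBetti S' (2 * 1) →ₗ[ℂ] complexBetti S (2 * 1)) := fun i =>
    (complexGysin ratFamily hSS' hS.1 (SemiCartesianMonoidalCategory.fst S S')
        (rfl : 2 * 1 + 2 * 2 + 2 * 2 = 2 * 1 + 2 * (2 + 2))) ∘ₗ
      ((cupProduct (rfl : 2 * 1 + 2 * 2 = 2 * 1 + 2 * 2)).flip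
          (g i : complexBetti (S ⊗ S') (2 * 2))) ∘ₗ
      (complexBetti.map (SemiCartesianMonoidalCategory.snd S S') (2 * 1)).hom
  have hθ : ∀ i y, θ i y = complexGysin ratFamily hSS' hS.1 (SemiCartesianMonoidalCategory.fst S S')
      (rfl : 2 * 1 + 2 * 2 + 2 * 2 = 2 * 1 + 2 * (2 + 2))
      (cupProduct (rfl : 2 * 1 + 2 * 2 = 2 * 1 + 2 * 2)
        (complexBetti.map (SemiCartesianMonoidalCategory.snd S S') (2 * 1) y) (g i)) :=
    fun i y => rfl
  have hψsum : ∀ y, ψ y = ∑ i, f i • θ i y := by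
    intro y
    rw [hψγ y, ← hsum, map_sum, map_sum]
    refine Finset.sum_congr rfl fun i _ => ?_
    rw [map_smul, map_smul, hθ]
  -- a Hodge model of `S × S′`
  obtain ⟨A⟩ := (hM (2 + 2) (S ⊗ S')).nonempty hSS'
  -- each `σᵢ = φ ∘ θᵢ ∘ φ′⁻¹` is defined over `ℚ` (Gysin along `ratFamily`, cup, pull-back preserve rationality)
  have hσrat : ∀ i (v : K3Index → ℤ), ∃ w : K3Index → ℚ,
      (φ.toLinearMap ∘ₗ θ i ∘ₗ φ'.symm.toLinearMap) (fun j => (v j : ℂ)) = fun j => (w j : ℂ) := by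
    intro i v
    have hint : IsIntegralClass (φ'.symm fun j => (v j : ℂ)) :=
      (hφ'int _).2 ⟨v, LinearEquiv.apply_symm_apply _ _⟩
    have hrat : IsRationalClass (θ i (φ'.symm fun j => (v j : ℂ))) := by
      rw [hθ]
      exact isRationalClass_complexGysin_ratFamily hSS' hS.1 _ _
        ((hint.isRationalClass.map _).cup rfl (g i).2.1)
    obtain ⟨w, hw⟩ := (isRationalClass_iff_of_marking hS φ hφint _).1 hrat
    exact ⟨w, hw⟩
  -- … and carries the twin period `N x₁` into the period line `ℂ x₁` (type calculus of `[γᵢ]_*`)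
  have hσper : ∀ i, ∃ tᵢ : ℂ,
      (φ.toLinearMap ∘ₗ θ i ∘ₗ φ'.symm.toLinearMap) (N x₁P) = tᵢ • x₁P := by
    intro i
    have hγT : IsOfHodgeType (2 + 2) (S ⊗ S') (2 * 2) 2 2 (g i : complexBetti (S ⊗ S') (2 * 2)) := by
      have hc : A.pullback (2 * 2) (g i : complexBetti (S ⊗ S') (2 * 2)) ∈ A.hodgeConiveau (2 * 2) 2 :=
        hG hSS' A (2 * 2) 2 ⟨g i, (g i).2.2, rfl⟩
      have hle : A.hodgeConiveau (2 * 2) 2 ≤ A.hodgePQ (2 * 2) 2 2 := by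
        refine iSup_le fun p₁ => iSup_le fun q₁ => iSup_le fun hpq => iSup_le fun hp₁ =>
          iSup_le fun hq₁ => ?_
        obtain ⟨rfl, rfl⟩ : p₁ = 2 ∧ q₁ = 2 := by omega
        exact le_rfl
      exact ⟨A, hle hc⟩
    have hsndT : IsOfHodgeType (2 + 2) (S ⊗ S') (2 * 1) 2 0
        (complexBetti.map (SemiCartesianMonoidalCategory.snd S S') (2 * 1) (φ'.symm (N x₁P))) :=
      IsOfHodgeType.map_of_independent hI h20' hSS' hS'.1 A (SemiCartesianMonoidalCategory.snd S S')
    have hcupT := cupPreservesHodgeType_of_nonempty_hodgeModel hI (hM (2 + 2) (S ⊗ S')) hdR hSS'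
      (rfl : 2 * 1 + 2 * 2 = 2 * 1 + 2 * 2) hsndT hγT
    have hgysT : IsOfHodgeType 2 S (2 * 1) 2 0 (θ i (φ'.symm (N x₁P))) := by
      rw [hθ]
      exact isOfHodgeType_complexGysin hI hM hdR ratFamily hSS' hS.1
        (SemiCartesianMonoidalCategory.fst S S')
        (rfl : 2 * 1 + 2 * 2 + 2 * 2 = 2 * 1 + 2 * (2 + 2)) (by norm_num) (by norm_num) hcupT
    obtain ⟨tᵢ, ht⟩ := h20span _ hgysT
    refine ⟨tᵢ, ?_⟩
    simp only [LinearMap.coe_comp, LinearEquiv.coe_coe, Function.comp_apply]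
    rw [ht, map_smul, LinearEquiv.apply_symm_apply]
  -- KEY LEMMA: hence `σᵢ (N a) ∈ ℂ a` for `a = e₁ + f₁`
  have hσa : ∀ i, ∃ tᵢ : ℂ,
      φ (θ i (φ'.symm (N fun j => (aV j : ℂ)))) = tᵢ • fun j => (aV j : ℂ) := by
    intro i
    obtain ⟨tᵢ, ht⟩ := hσper i
    refine ⟨tᵢ, ?_⟩
    have key := ratEnd_aV_of_eigen ((φ.toLinearMap ∘ₗ θ i ∘ₗ φ'.symm.toLinearMap) * N)
      (ratEnd_mul _ N (hσrat i) hNrat) (lam := tᵢ) (by rw [Module.End.mul_apply, ht])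
    rw [Module.End.mul_apply] at key
    exact key
  -- summing up: `R a = φ (ψ (φ′⁻¹ (N a))) ∈ ℂ a`, but its `e₂`-coordinate is `¾(√2+1) i ≠ 0`
  choose t ht using hσa
  have hRa : twistR (fun j => (aV j : ℂ)) = (∑ i, f i * t i) • fun j => (aV j : ℂ) := by
    have e1 : φ (ψ (φ'.symm (N fun j => (aV j : ℂ)))) = twistR (fun j => (aV j : ℂ)) := by
      rw [hψapply, LinearEquiv.apply_symm_apply, LinearEquiv.apply_symm_apply, hρdef,
        Module.End.mul_apply, hMN']
    rw [← e1, hψsum, map_sum, Finset.sum_smul]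
    refine Finset.sum_congr rfl fun i _ => ?_
    rw [map_smul, ht i, smul_smul]
  have he := congrFun hRa (Sum.inr (Sum.inr (Sum.inl 0)))
  simp only [Pi.smul_apply, smul_eq_mul] at he
  refine twistR_aV_e₂_ne_zero ?_
  rw [he]
  simp


end Summit.HodgeConjecture.HodgeConjecture.Theorems.TwinSimilitudeAlgebraic.Negative

end
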